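import Summits.QuantumFields.BalabanUV.T4Continuum.E3Cert.ZL2d4C0half.D_e0
import Summits.QuantumFields.BalabanUV.T4Continuum.E3Cert.ZL2d4C0half.D_e1
import Summits.QuantumFields.BalabanUV.T4Continuum.E3Cert.ZL2d4C0half.D_e2
import Summits.QuantumFields.BalabanUV.T4Continuum.E3Cert.ZL2d4C0half.D_e3
import Summits.QuantumFields.BalabanUV.T4Continuum.E3Cert.ZL2d4C0half.D_e4
import Summits.QuantumFields.BalabanUV.T4Continuum.E3Cert.ZL2d4C0half.D_e5
import Summits.QuantumFields.BalabanUV.T4Continuum.E3Cert.ZL2d4C0half.D_e6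
import Summits.QuantumFields.BalabanUV.T4Continuum.E3Cert.ZL2d4C0half.D_e7
import Summits.QuantumFields.BalabanUV.T4Continuum.E3Cert.ZL2d4C0half.D_e8
import Summits.QuantumFields.BalabanUV.T4Continuum.E3Cert.ZL2d4C0half.D_e9
import Summits.QuantumFields.BalabanUV.T4Continuum.E3Cert.ZL2d4C0half.D_e10
import Summits.QuantumFields.BalabanUV.T4Continuum.E3Cert.ZL2d4C0half.D_e11
import Summits.QuantumFields.BalabanUV.T4Continuum.E3Cert.ZL2d4C0half.D_e12
import Summits.QuantumFields.BalabanUV.T4Continuum.E3Cert.ZL2d4C0half.D_e13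
import Summits.QuantumFields.BalabanUV.T4Continuum.E3Cert.ZL2d4C0half.D_e14
import Summits.QuantumFields.BalabanUV.T4Continuum.E3Cert.ZL2d4C0half.D_e15
import Summits.QuantumFields.BalabanUV.T4Continuum.E3Cert.ZL2d4C0half.D_e16
import Summits.QuantumFields.BalabanUV.T4Continuum.E3Cert.E3PolyCertZ
/-! E3 certificate package `ZL2d4C0half` — module `D_e` ((4,2,1) block, d = 4, L = 2, type A small-field hypothesis c₀ = ½ ((x_t)₀ ≥ ½ on every link), γ = 923∕1024, M = 2²¹; emitter `bal_e3_lean_emit.py` output for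
`block-L2d4-su2-c0half-dyadic.json`, lane `run/shared/lean/ttrl/balaban-calc/e3/lean-draft/tree/zL2d4C0half/D_e.lean`; TREE COPY by the substrate cell (seat p3), typer
rulings (μ3)∕(ν2) = FINAL (μ6), journal l.19196 ∕ l.20020, following the E3 PILOT's scripted road (`substrate/p3/E3-PILOT.md` §1): import prefix
substituted and one-line docstrings added BY SCRIPT, no literal touched).  Meaning of the certificate: see `Data.lean` ∕ `Main.lean` of this package
and the checker `E3Cert/E3PolyCertZ*.lean`.  HONEST: certified computation on ONE small block — NOT Prop. (1.8), NOT an input of any NE row today,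
NOT infinite volume ∕ mass gap ∕ Clay. -/
set_option maxRecDepth 200000
set_option maxHeartbeats 0
namespace E3Z
/-- E3 certificate `zL2d4C0half` component: `zL2d4C0half_eqs` (lane output, transcribed verbatim; see the module docstring). -/
def zL2d4C0half_eqs : List (Poly × Poly × Poly) := [zL2d4C0half_e0, zL2d4C0half_e1, zL2d4C0half_e2, zL2d4C0half_e3, zL2d4C0half_e4, zL2d4C0half_e5, zL2d4C0half_e6, zL2d4C0half_e7, zL2d4C0half_e8, zL2d4C0half_e9, zL2d4C0half_e10, zL2d4C0half_e11, zL2d4C0half_e12, zL2d4C0half_e13, zL2d4C0half_e14, zL2d4C0half_e15, zL2d4C0half_e16]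
end E3Z
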